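import Summits.CriticalPhenomena.PercolationContinuityZ3.Theorems.PercNearOneGluingNoHeavyLowerTailSahiE3MajPatternRows
import Mathlib.Data.Fintype.Pi
import Mathlib.Data.Fin.VecNotation
import Mathlib.Tactic.Linarith
import Mathlib.Tactic.FinCases
import HarnessLib
import HarnessLib.Audit

/-!
# `NoHeavyLowerTail` (crux stmt-CriticalPhenomena-4575), Sahi programme P4 (Holley / monotone coupling):
# the `1+23` slot certificate on the pattern `2³` — combinatorial interface 1: saturated up-sets; pair condition rows

Support file (cell `prim-l12`, seat P4, generation 10; `--supports stmt-CriticalPhenomena-4575`).  No named facts, no sorries;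
standard axioms; def-free; no notation (the slot set is passed as `(M, hM : M = {100, 110, 101, 011, 111})`).

The pattern is `P = Fin 3 → Bool` (patterns of three join-primes `j₀, j₁, j₂`: coordinate `i` records `jᵢ ≤ x`); the slot set is
`OP = {100, 110, 101, 011, 111}` = "`x₀ ∨ (x₁ ∧ x₂)`" (preimage: `↑j₀ ∪ ↑(j₁ ⊔ j₂)`, the reduced pattern `1+23` of the programme's
census); `ν` is a weight on `P` with point masses `nE` (bottom), `n0, n1, n2` (atoms), `n01, n02, n12` (rank two), `nT` (top) and total
mass `Z` (a symbol: everything is homogeneous of degree three), and `R` retained masses with values `r0, r01, r02, r12, rT` on `OP`.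
All inequality texts are generated from ONE specification (HOME prim-l12-p4/code/gen10/x23) and consumed verbatim across the files
`…SahiE3OrPairPattern*`, `…SahiE3OrPairAlg*`, `…SahiE3OrPairCore*`, `…SahiE3OrPairSlot`.
* `sat_cases`: an `OP`-saturated up-set of `2³` (an up-set containing every point outside `OP` all of whose `OP`-successors it
  contains — the only up-sets the trace reduction `…SahiE3PatternReduction.pair_of_saturated` needs) is one of eleven explicit sets.
* `pair_row_*`: for each of them as first argument, the pair inequality of `…SahiE3PatternCertificate.phi_nonneg_of_patternCertificate`
  against all eleven second arguments, from the matching items of the canonical 68-item list (up-transport `ut_*`, `total`, `pair_*`).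
  This file: rows `empty`, `UT`, `U01`, `U02`; the other rows are in `…SahiE3OrPairPatternRows2/3`.
-/

namespace Summit.CriticalPhenomena.PercolationContinuityZ3.Theorems.SahiE3OrPairPattern

open Finset
open scoped BigOperators

/-- Order facts of the pattern `2³` used below (bottom, top, atoms below their rank-two successors, and the four
non-comparabilities atom `1`, `2` / the slot points not above them). [folklore] -/
theorem ord_orPair :
    (∀ x : Fin 3 → Bool, ![false, false, false] ≤ x) ∧ (∀ x : Fin 3 → Bool, x ≤ ![true, true, true]) ∧
    ![true, false, false] ≤ ![true, true, false] ∧ ![true, false, false] ≤ ![true, false, true] ∧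
        ![false, true, false] ≤ ![true, true, false] ∧ ![false, true, false] ≤ ![false, true, true] ∧
        ![false, false, true] ≤ ![true, false, true] ∧ ![false, false, true] ≤ ![false, true, true] ∧
    ¬ ![false, true, false] ≤ ![true, false, false] ∧ ¬ ![false, true, false] ≤ ![true, false, true] ∧
        ¬ ![false, false, true] ≤ ![true, false, false] ∧ ¬ ![false, false, true] ≤ ![true, true, false] := by
  letI : DecidableLE (Fin 3 → Bool) := fun a b => inferInstanceAs (Decidable (∀ i, a i ≤ b i))
  decide

/-- The `OP`-saturated up-sets of `2³` (`OP = {100, 110, 101, 011, 111}`; an up-set `S` such that an element outside `OP` all of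
whose `OP`-successors lie in `S` lies in `S` — the only up-sets the trace reduction `…SahiE3PatternReduction.pair_of_saturated`
needs) are exactly: `∅`, `{⊤}`, `↑(01)`, `↑(02)`, `↑(12)`, `↑(01) ∪ ↑(02)`, `↑0`, `↑1`, `↑2`, `↑1 ∪ ↑2`, everything. [this work] -/
theorem sat_cases (M : Finset (Fin 3 → Bool))
    (hM : M = {![true, false, false], ![true, true, false], ![true, false, true], ![false, true, true], ![true, true,
        true]}) (S : Finset (Fin 3 → Bool)) (hS : IsUpperSet (S : Set (Fin 3 → Bool)))
    (hsat : ∀ s ∈ Mᶜ, (∀ t ∈ M, s ≤ t → t ∈ S) → s ∈ S) :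
    S = ∅ ∨ S = ({![true, true, true]} : Finset (Fin 3 → Bool)) ∨ S = ({![true, true, false], ![true, true,
        true]} : Finset (Fin 3 → Bool)) ∨ S = ({![true, false, true], ![true, true,
        true]} : Finset (Fin 3 → Bool)) ∨ S = ({![false, true, true], ![true, true,
        true]} : Finset (Fin 3 → Bool)) ∨ S = ({![true, true, false], ![true, false, true], ![true, true,
        true]} : Finset (Fin 3 → Bool)) ∨ S = ({![true, false, false], ![true, true, false], ![true, false, true],
        ![true, true, true]} : Finset (Fin 3 → Bool)) ∨ S = ({![false, true, false], ![true, true, false], ![false,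
        true, true], ![true, true, true]} : Finset (Fin 3 → Bool)) ∨ S = ({![false, false, true], ![true, false,
        true], ![false, true, true], ![true, true, true]} : Finset (Fin 3 → Bool)) ∨ S = ({![false, true, false],
        ![false, false, true], ![true, true, false], ![true, false, true], ![false, true, true], ![true, true,
        true]} : Finset (Fin 3 → Bool)) ∨ S = univ := by
  subst hM
  obtain ⟨hbot, htop, l001, l002, l101, l112, l202, l212, n10, n102, n20, n201⟩ := ord_orPair
  have up : ∀ {x y : Fin 3 → Bool}, x ≤ y → x ∈ S → y ∈ S := fun hxy hx => hS hxy hx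
  have mem5 : ∀ {t : Fin 3 → Bool}, t ∈ ({![true, false, false], ![true, true, false], ![true, false, true], ![false,
      true, true], ![true, true, true]} : Finset (Fin 3 → Bool)) →
      t = ![true, false, false] ∨ t = ![true, true, false] ∨ t = ![true, false, true] ∨ t = ![false, true,
          true] ∨ t = ![true, true, true] := by
    intro t h
    simpa only [Finset.mem_insert, Finset.mem_singleton] using h
  by_cases hb : ![false, false, false] ∈ S
  · refine Or.inr (Or.inr (Or.inr (Or.inr (Or.inr (Or.inr (Or.inr (Or.inr (Or.inr (Or.inr (?_))))))))))
    ext x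
    simp only [Finset.mem_univ, iff_true]
    exact up (hbot x) hb
  by_cases ht : ![true, true, true] ∈ S
  swap
  · refine Or.inl ?_
    ext x
    simp only [Finset.notMem_empty, iff_false]
    exact fun hx => ht (up (htop x) hx)
  have h1 : ![false, true, false] ∈ S ↔ ![true, true, false] ∈ S ∧ ![false, true, true] ∈ S := by
    refine ⟨fun h => ⟨up l101 h, up l112 h⟩, fun h => hsat _ (by decide) fun t htM hle => ?_⟩
    rcases mem5 htM with rfl | rfl | rfl | rfl | rfl
    exacts [absurd hle n10, h.1, absurd hle n102, h.2, ht]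
  have h2 : ![false, false, true] ∈ S ↔ ![true, false, true] ∈ S ∧ ![false, true, true] ∈ S := by
    refine ⟨fun h => ⟨up l202 h, up l212 h⟩, fun h => hsat _ (by decide) fun t htM hle => ?_⟩
    rcases mem5 htM with rfl | rfl | rfl | rfl | rfl
    exacts [absurd hle n20, absurd hle n201, h.1, h.2, ht]
  have h0a : ![true, false, false] ∈ S → ![true, true, false] ∈ S := fun h => up l001 h
  have h0b : ![true, false, false] ∈ S → ![true, false, true] ∈ S := fun h => up l002 h
  have hnot : ¬ (![true, false, false] ∈ S ∧ ![false, true, true] ∈ S) := fun h =>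
    hb (hsat _ (by decide) fun t htM _ => by
      rcases mem5 htM with rfl | rfl | rfl | rfl | rfl
      exacts [h.1, h0a h.1, h0b h.1, h.2, ht])
  by_cases c01 : ![true, true, false] ∈ S <;> by_cases c02 : ![true, false, true] ∈ S <;> by_cases c12 : ![false,
      true, true] ∈ S <;>
    by_cases c0 : ![true, false, false] ∈ S
  · exact absurd ⟨c0, c12⟩ hnot
  · -- U1_2
    have a1 : ![false, true, false] ∈ S := h1.2 ⟨c01, c12⟩
    have a2 : ![false, false, true] ∈ S := h2.2 ⟨c02, c12⟩
    refine Or.inr (Or.inr (Or.inr (Or.inr (Or.inr (Or.inr (Or.inr (Or.inr (Or.inr (Or.inl ?_)))))))))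
    ext x
    rcases SahiE3MajPattern.pts x with rfl | rfl | rfl | rfl | rfl | rfl | rfl | rfl <;> simp [hb, ht, c01, c02, c12,
        c0, a1, a2]
  · -- U0
    have a1 : ![false, true, false] ∉ S := fun h => c12 (h1.1 h).2
    have a2 : ![false, false, true] ∉ S := fun h => c12 (h2.1 h).2
    refine Or.inr (Or.inr (Or.inr (Or.inr (Or.inr (Or.inr (Or.inl ?_))))))
    ext x
    rcases SahiE3MajPattern.pts x with rfl | rfl | rfl | rfl | rfl | rfl | rfl | rfl <;> simp [hb, ht, c01, c02, c12,
        c0, a1, a2]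
  · -- U01_02
    have a1 : ![false, true, false] ∉ S := fun h => c12 (h1.1 h).2
    have a2 : ![false, false, true] ∉ S := fun h => c12 (h2.1 h).2
    refine Or.inr (Or.inr (Or.inr (Or.inr (Or.inr (Or.inl ?_)))))
    ext x
    rcases SahiE3MajPattern.pts x with rfl | rfl | rfl | rfl | rfl | rfl | rfl | rfl <;> simp [hb, ht, c01, c02, c12,
        c0, a1, a2]
  · exact absurd (h0b c0) c02
  · -- U1
    have a1 : ![false, true, false] ∈ S := h1.2 ⟨c01, c12⟩
    have a2 : ![false, false, true] ∉ S := fun h => c02 (h2.1 h).1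
    refine Or.inr (Or.inr (Or.inr (Or.inr (Or.inr (Or.inr (Or.inr (Or.inl ?_)))))))
    ext x
    rcases SahiE3MajPattern.pts x with rfl | rfl | rfl | rfl | rfl | rfl | rfl | rfl <;> simp [hb, ht, c01, c02, c12,
        c0, a1, a2]
  · exact absurd (h0b c0) c02
  · -- U01
    have a1 : ![false, true, false] ∉ S := fun h => c12 (h1.1 h).2
    have a2 : ![false, false, true] ∉ S := fun h => c12 (h2.1 h).2
    refine Or.inr (Or.inr (Or.inl ?_))
    ext x
    rcases SahiE3MajPattern.pts x with rfl | rfl | rfl | rfl | rfl | rfl | rfl | rfl <;> simp [hb, ht, c01, c02, c12,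
        c0, a1, a2]
  · exact absurd (h0a c0) c01
  · -- U2
    have a1 : ![false, true, false] ∉ S := fun h => c01 (h1.1 h).1
    have a2 : ![false, false, true] ∈ S := h2.2 ⟨c02, c12⟩
    refine Or.inr (Or.inr (Or.inr (Or.inr (Or.inr (Or.inr (Or.inr (Or.inr (Or.inl ?_))))))))
    ext x
    rcases SahiE3MajPattern.pts x with rfl | rfl | rfl | rfl | rfl | rfl | rfl | rfl <;> simp [hb, ht, c01, c02, c12,
        c0, a1, a2]
  · exact absurd (h0a c0) c01
  · -- U02
    have a1 : ![false, true, false] ∉ S := fun h => c12 (h1.1 h).2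
    have a2 : ![false, false, true] ∉ S := fun h => c12 (h2.1 h).2
    refine Or.inr (Or.inr (Or.inr (Or.inl ?_)))
    ext x
    rcases SahiE3MajPattern.pts x with rfl | rfl | rfl | rfl | rfl | rfl | rfl | rfl <;> simp [hb, ht, c01, c02, c12,
        c0, a1, a2]
  · exact absurd (h0a c0) c01
  · -- U12
    have a1 : ![false, true, false] ∉ S := fun h => c01 (h1.1 h).1
    have a2 : ![false, false, true] ∉ S := fun h => c02 (h2.1 h).1
    refine Or.inr (Or.inr (Or.inr (Or.inr (Or.inl ?_))))
    ext x
    rcases SahiE3MajPattern.pts x with rfl | rfl | rfl | rfl | rfl | rfl | rfl | rfl <;> simp [hb, ht, c01, c02, c12,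
        c0, a1, a2]
  · exact absurd (h0a c0) c01
  · -- UT
    have a1 : ![false, true, false] ∉ S := fun h => c12 (h1.1 h).2
    have a2 : ![false, false, true] ∉ S := fun h => c12 (h2.1 h).2
    refine Or.inr (Or.inl ?_)
    ext x
    rcases SahiE3MajPattern.pts x with rfl | rfl | rfl | rfl | rfl | rfl | rfl | rfl <;> simp [hb, ht, c01, c02, c12,
        c0, a1, a2]

/-- Row `S = empty` of the pair condition: the eleven saturated `S'` (see `pair_all`). [this work] -/
theorem pair_row_empty (M : Finset (Fin 3 → Bool))
    (hM : M = {![true, false, false], ![true, true, false], ![true, false, true], ![false, true, true], ![true, true,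
        true]}) (ν : (Fin 3 → Bool) → ℝ) (n0 n1 n2 n01 n02 n12 nT Z : ℝ)
    (hZ : ∑ t, ν t = Z) (h0 : ν ![true, false, false] = n0) (h1 : ν ![false, true, false] = n1) (h2 : ν ![false,
        false, true] = n2) (h01 : ν ![true, true, false] = n01) (h02 : ν ![true, false,
        true] = n02) (h12 : ν ![false, true, true] = n12) (hT : ν ![true, true, true] = nT)
    (R : (Fin 3 → Bool) → ℝ) 
    (S' : Finset (Fin 3 → Bool)) (hS' : IsUpperSet (S' : Set (Fin 3 → Bool)))
    (hsS' : ∀ s ∈ Mᶜ, (∀ t ∈ M, s ≤ t → t ∈ S') → s ∈ S') :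
    Z * ((∑ t ∈ (∅ : Finset (Fin 3 → Bool)), ν t) * (∑ t ∈ S' ∩ M, ν t)
        + (∑ t ∈ S', ν t) * (∑ t ∈ (∅ : Finset (Fin 3 → Bool)) ∩ M, ν t))
        - (n0 + n01 + n02 + n12 + nT) * (∑ t ∈ (∅ : Finset (Fin 3 → Bool)), ν t) * (∑ t ∈ S', ν t)
      ≤ ∑ t ∈ ((∅ : Finset (Fin 3 → Bool)) ∩ S') ∩ M, R t := by
  subst hM
  rcases sat_cases _ rfl S' hS' hsS' with rfl | rfl | rfl | rfl | rfl | rfl | rfl | rfl | rfl | rfl | rfl <;>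
  · simp (disch := decide) only [Finset.empty_inter, Finset.inter_empty, Finset.univ_inter, Finset.inter_univ,
      Finset.insert_inter_of_mem, Finset.insert_inter_of_notMem, Finset.singleton_inter_of_mem,
      Finset.sum_empty, Finset.sum_singleton, Finset.sum_insert, hZ,
      h0, h1, h2, h01, h02, h12, hT]
    linarith

/-- Row `S = UT` of the pair condition: the eleven saturated `S'` (see `pair_all`). [this work] -/
theorem pair_row_UT (M : Finset (Fin 3 → Bool))
    (hM : M = {![true, false, false], ![true, true, false], ![true, false, true], ![false, true, true], ![true, true,
        true]}) (ν : (Fin 3 → Bool) → ℝ) (n0 n1 n2 n01 n02 n12 nT Z : ℝ)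
    (hZ : ∑ t, ν t = Z) (h0 : ν ![true, false, false] = n0) (h1 : ν ![false, true, false] = n1) (h2 : ν ![false,
        false, true] = n2) (h01 : ν ![true, true, false] = n01) (h02 : ν ![true, false,
        true] = n02) (h12 : ν ![false, true, true] = n12) (hT : ν ![true, true, true] = nT) (rT : ℝ)
    (R : (Fin 3 → Bool) → ℝ) (hRT : R ![true, true, true] = rT)
    (h_pair_UT__UT : Z * (nT * nT + nT * nT) - (n0 + n01 + n02 + n12 + nT) * nT * nT ≤ rT)
    (h_pair_UT__U01 : Z * (nT * (n01 + nT) + (n01 + nT) * nT) - (n0 + n01 + n02 + n12 + nT) * nT * (n01 + nT) ≤ rT)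
    (h_pair_UT__U02 : Z * (nT * (n02 + nT) + (n02 + nT) * nT) - (n0 + n01 + n02 + n12 + nT) * nT * (n02 + nT) ≤ rT)
    (h_pair_UT__U12 : Z * (nT * (n12 + nT) + (n12 + nT) * nT) - (n0 + n01 + n02 + n12 + nT) * nT * (n12 + nT) ≤ rT)
    (h_pair_UT__U01_02 : Z * (nT * (n01 + n02 + nT) + (n01 + n02 + nT) * nT) - (n0 + n01 + n02 + n12 +
        nT) * nT * (n01 + n02 + nT) ≤ rT)
    (h_pair_UT__U0 : Z * (nT * (n0 + n01 + n02 + nT) + (n0 + n01 + n02 + nT) * nT) - (n0 + n01 + n02 + n12 +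
        nT) * nT * (n0 + n01 + n02 + nT) ≤ rT)
    (h_pair_UT__U1 : Z * (nT * (n01 + n12 + nT) + (n1 + n01 + n12 + nT) * nT) - (n0 + n01 + n02 + n12 +
        nT) * nT * (n1 + n01 + n12 + nT) ≤ rT)
    (h_pair_UT__U2 : Z * (nT * (n02 + n12 + nT) + (n2 + n02 + n12 + nT) * nT) - (n0 + n01 + n02 + n12 +
        nT) * nT * (n2 + n02 + n12 + nT) ≤ rT)
    (h_pair_UT__U1_2 : Z * (nT * (n01 + n02 + n12 + nT) + (n1 + n2 + n01 + n02 + n12 + nT) * nT) - (n0 + n01 + n02 +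
        n12 + nT) * nT * (n1 + n2 + n01 + n02 + n12 + nT) ≤ rT)
    (h_ut_UT : Z * Z * nT ≤ rT)
    (S' : Finset (Fin 3 → Bool)) (hS' : IsUpperSet (S' : Set (Fin 3 → Bool)))
    (hsS' : ∀ s ∈ Mᶜ, (∀ t ∈ M, s ≤ t → t ∈ S') → s ∈ S') :
    Z * ((∑ t ∈ ({![true, true, true]} : Finset (Fin 3 → Bool)), ν t) * (∑ t ∈ S' ∩ M, ν t)
        + (∑ t ∈ S', ν t) * (∑ t ∈ ({![true, true, true]} : Finset (Fin 3 → Bool)) ∩ M, ν t))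
        - (n0 + n01 + n02 + n12 + nT) * (∑ t ∈ ({![true, true, true]} : Finset (Fin 3 → Bool)), ν t) * (∑ t ∈ S', ν t)
      ≤ ∑ t ∈ (({![true, true, true]} : Finset (Fin 3 → Bool)) ∩ S') ∩ M, R t := by
  subst hM
  rcases sat_cases _ rfl S' hS' hsS' with rfl | rfl | rfl | rfl | rfl | rfl | rfl | rfl | rfl | rfl | rfl <;>
  · simp (disch := decide) only [Finset.empty_inter, Finset.inter_empty, Finset.univ_inter, Finset.inter_univ,
      Finset.insert_inter_of_mem, Finset.insert_inter_of_notMem, Finset.singleton_inter_of_mem,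
      Finset.sum_empty, Finset.sum_singleton, Finset.sum_insert, hZ,
      hRT, h0, h1, h2, h01, h02, h12, hT]
    linarith

/-- Row `S = U01` of the pair condition: the eleven saturated `S'` (see `pair_all`). [this work] -/
theorem pair_row_U01 (M : Finset (Fin 3 → Bool))
    (hM : M = {![true, false, false], ![true, true, false], ![true, false, true], ![false, true, true], ![true, true,
        true]}) (ν : (Fin 3 → Bool) → ℝ) (n0 n1 n2 n01 n02 n12 nT Z : ℝ)
    (hZ : ∑ t, ν t = Z) (h0 : ν ![true, false, false] = n0) (h1 : ν ![false, true, false] = n1) (h2 : ν ![false,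
        false, true] = n2) (h01 : ν ![true, true, false] = n01) (h02 : ν ![true, false,
        true] = n02) (h12 : ν ![false, true, true] = n12) (hT : ν ![true, true, true] = nT) (r01 rT : ℝ)
    (R : (Fin 3 → Bool) → ℝ) (hR01 : R ![true, true, false] = r01) (hRT : R ![true, true, true] = rT)
    (h_pair_UT__U01 : Z * (nT * (n01 + nT) + (n01 + nT) * nT) - (n0 + n01 + n02 + n12 + nT) * nT * (n01 + nT) ≤ rT)
    (h_pair_U01__U01 : Z * ((n01 + nT) * (n01 + nT) + (n01 + nT) * (n01 + nT)) - (n0 + n01 + n02 + n12 + nT) * (n01 +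
        nT) * (n01 + nT) ≤ r01 + rT)
    (h_pair_U01__U02 : Z * ((n01 + nT) * (n02 + nT) + (n02 + nT) * (n01 + nT)) - (n0 + n01 + n02 + n12 + nT) * (n01 +
        nT) * (n02 + nT) ≤ rT)
    (h_pair_U01__U12 : Z * ((n01 + nT) * (n12 + nT) + (n12 + nT) * (n01 + nT)) - (n0 + n01 + n02 + n12 + nT) * (n01 +
        nT) * (n12 + nT) ≤ rT)
    (h_pair_U01__U01_02 : Z * ((n01 + nT) * (n01 + n02 + nT) + (n01 + n02 + nT) * (n01 + nT)) - (n0 + n01 + n02 +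
        n12 + nT) * (n01 + nT) * (n01 + n02 + nT) ≤ r01 + rT)
    (h_pair_U01__U0 : Z * ((n01 + nT) * (n0 + n01 + n02 + nT) + (n0 + n01 + n02 + nT) * (n01 + nT)) - (n0 + n01 +
        n02 + n12 + nT) * (n01 + nT) * (n0 + n01 + n02 + nT) ≤ r01 + rT)
    (h_pair_U01__U1 : Z * ((n01 + nT) * (n01 + n12 + nT) + (n1 + n01 + n12 + nT) * (n01 + nT)) - (n0 + n01 + n02 +
        n12 + nT) * (n01 + nT) * (n1 + n01 + n12 + nT) ≤ r01 + rT)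
    (h_pair_U01__U2 : Z * ((n01 + nT) * (n02 + n12 + nT) + (n2 + n02 + n12 + nT) * (n01 + nT)) - (n0 + n01 + n02 +
        n12 + nT) * (n01 + nT) * (n2 + n02 + n12 + nT) ≤ rT)
    (h_pair_U01__U1_2 : Z * ((n01 + nT) * (n01 + n02 + n12 + nT) + (n1 + n2 + n01 + n02 + n12 + nT) * (n01 +
        nT)) - (n0 + n01 + n02 + n12 + nT) * (n01 + nT) * (n1 + n2 + n01 + n02 + n12 + nT) ≤ r01 + rT)
    (h_ut_U01 : Z * Z * (n01 + nT) ≤ r01 + rT)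
    (S' : Finset (Fin 3 → Bool)) (hS' : IsUpperSet (S' : Set (Fin 3 → Bool)))
    (hsS' : ∀ s ∈ Mᶜ, (∀ t ∈ M, s ≤ t → t ∈ S') → s ∈ S') :
    Z * ((∑ t ∈ ({![true, true, false], ![true, true, true]} : Finset (Fin 3 → Bool)), ν t) * (∑ t ∈ S' ∩ M, ν t)
        + (∑ t ∈ S', ν t) * (∑ t ∈ ({![true, true, false], ![true, true, true]} : Finset (Fin 3 → Bool)) ∩ M, ν t))
        - (n0 + n01 + n02 + n12 + nT) * (∑ t ∈ ({![true, true, false], ![true, true, true]} : Finset (Fin 3 → Bool)),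
            ν t) * (∑ t ∈ S', ν t)
      ≤ ∑ t ∈ (({![true, true, false], ![true, true, true]} : Finset (Fin 3 → Bool)) ∩ S') ∩ M, R t := by
  subst hM
  rcases sat_cases _ rfl S' hS' hsS' with rfl | rfl | rfl | rfl | rfl | rfl | rfl | rfl | rfl | rfl | rfl <;>
  · simp (disch := decide) only [Finset.empty_inter, Finset.inter_empty, Finset.univ_inter, Finset.inter_univ,
      Finset.insert_inter_of_mem, Finset.insert_inter_of_notMem, Finset.singleton_inter_of_mem,
      Finset.sum_empty, Finset.sum_singleton, Finset.sum_insert, hZ,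
      hR01, hRT, h0, h1, h2, h01, h02, h12, hT]
    linarith

/-- Row `S = U02` of the pair condition: the eleven saturated `S'` (see `pair_all`). [this work] -/
theorem pair_row_U02 (M : Finset (Fin 3 → Bool))
    (hM : M = {![true, false, false], ![true, true, false], ![true, false, true], ![false, true, true], ![true, true,
        true]}) (ν : (Fin 3 → Bool) → ℝ) (n0 n1 n2 n01 n02 n12 nT Z : ℝ)
    (hZ : ∑ t, ν t = Z) (h0 : ν ![true, false, false] = n0) (h1 : ν ![false, true, false] = n1) (h2 : ν ![false,
        false, true] = n2) (h01 : ν ![true, true, false] = n01) (h02 : ν ![true, false,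
        true] = n02) (h12 : ν ![false, true, true] = n12) (hT : ν ![true, true, true] = nT) (r02 rT : ℝ)
    (R : (Fin 3 → Bool) → ℝ) (hR02 : R ![true, false, true] = r02) (hRT : R ![true, true, true] = rT)
    (h_pair_UT__U02 : Z * (nT * (n02 + nT) + (n02 + nT) * nT) - (n0 + n01 + n02 + n12 + nT) * nT * (n02 + nT) ≤ rT)
    (h_pair_U01__U02 : Z * ((n01 + nT) * (n02 + nT) + (n02 + nT) * (n01 + nT)) - (n0 + n01 + n02 + n12 + nT) * (n01 +
        nT) * (n02 + nT) ≤ rT)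
    (h_pair_U02__U02 : Z * ((n02 + nT) * (n02 + nT) + (n02 + nT) * (n02 + nT)) - (n0 + n01 + n02 + n12 + nT) * (n02 +
        nT) * (n02 + nT) ≤ r02 + rT)
    (h_pair_U02__U12 : Z * ((n02 + nT) * (n12 + nT) + (n12 + nT) * (n02 + nT)) - (n0 + n01 + n02 + n12 + nT) * (n02 +
        nT) * (n12 + nT) ≤ rT)
    (h_pair_U02__U01_02 : Z * ((n02 + nT) * (n01 + n02 + nT) + (n01 + n02 + nT) * (n02 + nT)) - (n0 + n01 + n02 +
        n12 + nT) * (n02 + nT) * (n01 + n02 + nT) ≤ r02 + rT)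
    (h_pair_U02__U0 : Z * ((n02 + nT) * (n0 + n01 + n02 + nT) + (n0 + n01 + n02 + nT) * (n02 + nT)) - (n0 + n01 +
        n02 + n12 + nT) * (n02 + nT) * (n0 + n01 + n02 + nT) ≤ r02 + rT)
    (h_pair_U02__U1 : Z * ((n02 + nT) * (n01 + n12 + nT) + (n1 + n01 + n12 + nT) * (n02 + nT)) - (n0 + n01 + n02 +
        n12 + nT) * (n02 + nT) * (n1 + n01 + n12 + nT) ≤ rT)
    (h_pair_U02__U2 : Z * ((n02 + nT) * (n02 + n12 + nT) + (n2 + n02 + n12 + nT) * (n02 + nT)) - (n0 + n01 + n02 +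
        n12 + nT) * (n02 + nT) * (n2 + n02 + n12 + nT) ≤ r02 + rT)
    (h_pair_U02__U1_2 : Z * ((n02 + nT) * (n01 + n02 + n12 + nT) + (n1 + n2 + n01 + n02 + n12 + nT) * (n02 +
        nT)) - (n0 + n01 + n02 + n12 + nT) * (n02 + nT) * (n1 + n2 + n01 + n02 + n12 + nT) ≤ r02 + rT)
    (h_ut_U02 : Z * Z * (n02 + nT) ≤ r02 + rT)
    (S' : Finset (Fin 3 → Bool)) (hS' : IsUpperSet (S' : Set (Fin 3 → Bool)))
    (hsS' : ∀ s ∈ Mᶜ, (∀ t ∈ M, s ≤ t → t ∈ S') → s ∈ S') :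
    Z * ((∑ t ∈ ({![true, false, true], ![true, true, true]} : Finset (Fin 3 → Bool)), ν t) * (∑ t ∈ S' ∩ M, ν t)
        + (∑ t ∈ S', ν t) * (∑ t ∈ ({![true, false, true], ![true, true, true]} : Finset (Fin 3 → Bool)) ∩ M, ν t))
        - (n0 + n01 + n02 + n12 + nT) * (∑ t ∈ ({![true, false, true], ![true, true, true]} : Finset (Fin 3 → Bool)),
            ν t) * (∑ t ∈ S', ν t)
      ≤ ∑ t ∈ (({![true, false, true], ![true, true, true]} : Finset (Fin 3 → Bool)) ∩ S') ∩ M, R t := by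
  subst hM
  rcases sat_cases _ rfl S' hS' hsS' with rfl | rfl | rfl | rfl | rfl | rfl | rfl | rfl | rfl | rfl | rfl <;>
  · simp (disch := decide) only [Finset.empty_inter, Finset.inter_empty, Finset.univ_inter, Finset.inter_univ,
      Finset.insert_inter_of_mem, Finset.insert_inter_of_notMem, Finset.singleton_inter_of_mem,
      Finset.sum_empty, Finset.sum_singleton, Finset.sum_insert, hZ,
      hR02, hRT, h0, h1, h2, h01, h02, h12, hT]
    linarith

end Summit.CriticalPhenomena.PercolationContinuityZ3.Theorems.SahiE3OrPairPattern
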